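import Summits.AtomisticToContinuum.Crystallization.Theorems.FrustratedLawDichotomyStrainedPatchEnvelopeLaw

/-!
# (F1ʳ-bent₀) decomposed — level 2: the second-order expansion of the score along fine charts (lens-5 g53 «EnvelopeTaylor»)

Decomposes **(ENV_P) `FamilyEnvelopeOn P 𝓘 τ tmax Ψ'`** (level 1, «EnvelopeLaw») — the plain envelope on a family below the range `tmax` — into four pieces
joined by a PROVED seam of pure inequalities (`familyEnvelopeOn_of_taylor`):

* **(BAS) `InteriorBasin 𝓘 τ κA tmax δ`** [ANALYTIC — quantitative implicit-function statement · UNDECIDED · INSTRUMENTABLE] — an admissible (force-capped,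
  clean, mono-phase) cluster charted (`τ`, fine `κA·t`, `t ≤ tmax`) by an instance is FINELY charted: the deviation field `dev` is `≤ δ` on the WHOLE
  `63/10`-ball (the interior follows the annulus: force cap `σ₁` + uniform stability of the capped interior).
* **(T2) `SmoothTaylorTwo 𝓘 τ δ G w ϱ`** [CALCULUS — THE SECOND-ORDER REMAINDER LEMMA · TRUE-type · ATTACKABLE] — for a `δ`-fine chart, the cluster's
  smooth surpluses averaged with the INSTANCE's memberships and normalisers (`frozenAvg`) exceed `S(z₁) + lin_G(dev) − quad_w(dev) − ϱ(z₁)`: first order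
  through the gradient table `G`, second order through the translation-invariant PAIR-DIFFERENCE form `Σ w(b,b')‖dev a − dev a'‖²` (a sup-norm remainder
  `q·Σ‖dev‖²` is hopeless: `≈ 38·(2t)²` against margins `6·10⁻⁴`), rim column `ϱ` for the uncovered shell `(63/10 − τ, 63/10]`.  No admissibility beyond
  separation, no mechanics: `W₄₅ ∈ C^{1,1}` and Taylor's theorem pair by pair.
* **(MEM) `MembershipColumn 𝓘 τ δ μ`** [COMBINATORIAL + TABLE · INSTRUMENTABLE] — the true score `S(z)` (the cluster's own `9/5`-balls) is at least
  `frozenAvg − μ(z₁)`: membership and normaliser transitions across the sphere of radius `9/5` are PRICED by the column `μ`, zero on instances whose shells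
  clear `9/5 ± 2δ` (there the balls agree), positive on the marginal ones — and marginal instances are GENERIC in the window band: the strained third shell
  `√3·d·(1+O(η))` crosses `9/5` (instrument KBAND53: clearance `0` for fcc/hcp at `d ∈ [0.94, 1.03]`, levels in `(1/20, 7/100]`).
* **(LIN) `SlavedFirstOrder P 𝓘 τ κA tmax δ G w Ψ`** [MECHANICS — the slaving estimate · UNDECIDED · INSTRUMENTABLE (census cone-LP, ASK11⁺ + quadratic)] —
  for admissible clusters so charted, with chart predicate `P … t` (`projectedFree`: the annulus deviation is `(1−P)u`, `‖u‖ ≤ t`):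
  `lin_G(dev) − quad_w(dev) ≥ −Ψ(z₁)(t)` (`⟨G, (1−P)u⟩ = ⟨(1−P)ᵀG, u⟩ ≤ ‖G_na‖₁·t`: the census's affine-quotiented columns, no amplification).  No score in it.

★ SEAM: (BAS) ∧ (T2) ∧ (MEM) ∧ (LIN) ⟹ (ENV_P) with `Ψ' = Ψ + ϱ + μ`.  §4 pins `δ₀ = 1/20`, the TRUE gradient table `G₀` (Fréchet derivative of the frozen
smooth score), the curvature weight `w₀` (band majorants `K(r) ≥ sup_{|s−r| ≤ 1/10} max(|W''|, |W'|/s)`, instrument KBAND53 ×1.2) and the rim column `ϱ₀`;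
§5 instantiates on the comparison family `𝓘₁⁺` of LINE A⁺ and assembles, with «EnvelopeLaw», the ten-piece node
(BAS-bent₁) ∧ (T2-bent₁) ∧ (MEM-bent₁ μ) ∧ (LIN-bent₁ Ψ) ∧ (RF-bent₁) ∧ (DOM-bent₁ (Ψ+ϱ₀+μ)) ∧ (F2-bent₀) ∧ (F3-bent₁) ∧ [BRIDGE] ∧ [SOFT-FAR] ⟹ [CORE-FAR].
-/

namespace Summit.AtomisticToContinuum.Crystallization.Theorems.FrustratedLawDichotomyStrainedPatchEnvelopeTaylor

open scoped BigOperators Classical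
open Summit.AtomisticToContinuum.Crystallization.Theorems.FrustratedLawDichotomyPeriodicBlockFlags (goodAtScale_mono)
open Summit.AtomisticToContinuum.Crystallization.Theorems.FrustratedLawDichotomyMotifLemmas
open Summit.AtomisticToContinuum.Crystallization.Theorems.FrustratedLawDichotomyAveragingCut
open Summit.AtomisticToContinuum.Crystallization.Theorems.FrustratedLawDichotomyAveragingRuleCap
open Summit.AtomisticToContinuum.Crystallization.Theorems.FrustratedLawDichotomyAveragingRuleTightFree
open Summit.AtomisticToContinuum.Crystallization.Theorems.FrustratedLawDichotomyRuleToolkitGood (goodFlag)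
open Summit.AtomisticToContinuum.Crystallization.Theorems.FrustratedLawDichotomySchurCut (effPot w₄₅ ω₄)
open Summit.AtomisticToContinuum.Crystallization.Theorems.FrustratedLawDichotomyExemptDoor (SitePred)
open Summit.AtomisticToContinuum.Crystallization.Theorems.FrustratedLawDichotomyExemptAbsorption
open Summit.AtomisticToContinuum.Crystallization.Theorems.FrustratedLawDichotomyExemptAbsorptionRecord
open Summit.AtomisticToContinuum.Crystallization.Theorems.FrustratedLawDichotomyCollarCensus
open Summit.AtomisticToContinuum.Crystallization.Theorems.FrustratedLawDichotomyCollarCensusKappa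
open Summit.AtomisticToContinuum.Crystallization.Theorems.FrustratedLawDichotomyStrainedPatchHomSplit
open Summit.AtomisticToContinuum.Crystallization.Theorems.FrustratedLawDichotomyStrainedPatchCleanCollar
open Summit.AtomisticToContinuum.Crystallization.Theorems.FrustratedLawDichotomyStrainedPatchHomTube
open Summit.AtomisticToContinuum.Crystallization.Theorems.FrustratedLawDichotomyStrainedPatchHomIsometry
open Summit.AtomisticToContinuum.Crystallization.Theorems.FrustratedLawDichotomyStrainedPatchHomTubeIso
open Summit.AtomisticToContinuum.Crystallization.Theorems.FrustratedLawDichotomyStrainedPatchPhaseCut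
open Summit.AtomisticToContinuum.Crystallization.Theorems.FrustratedLawDichotomyStrainedPatchCoreTube
open Summit.AtomisticToContinuum.Crystallization.Theorems.FrustratedLawDichotomyStrainedPatchCoreTubeRecord
open Summit.AtomisticToContinuum.Crystallization.Theorems.FrustratedLawDichotomyStrainedPatchCoreTubeMilli
open Summit.AtomisticToContinuum.Crystallization.Theorems.FrustratedLawDichotomyStrainedPatchStrainBands
open Summit.AtomisticToContinuum.Crystallization.Theorems.FrustratedLawDichotomyStrainedPatchChartFamilies
open Summit.AtomisticToContinuum.Crystallization.Theorems.FrustratedLawDichotomyStrainedPatchChartFamiliesBent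
open Summit.AtomisticToContinuum.Crystallization.Theorems.FrustratedLawDichotomyStrainedPatchChartFamiliesPinned
open Summit.AtomisticToContinuum.Crystallization.Theorems.FrustratedLawDichotomyStrainedPatchEnvelopeLaw

/-! ## §1. The smooth surplus, the frozen average, fine charts, the two expansion terms -/

/-- The pair potential of the record score: `W = effPot w₄₅ ω₄ (3/400)` (`C^{1,1}`, range `9/2`). -/
noncomputable def Wrec : ℝ → ℝ := effPot w₄₅ ω₄ (3 / 400)

/-- The SMOOTH site surplus: `xRec` without its flag columns, `x̃_j(z) = (Σ_k W(r_jk) − W(0))/2 − e_W`. -/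
noncomputable def xSm (M : ℕ) (z : Fin M → E3) (j : Fin M) : ℝ := (pairSumFeature Wrec M z j - Wrec 0) / 2 - (-(7175 / 10000) + 3 / 400)

/-- At a `1/8`-good site the record surplus IS the smooth surplus (flag `1`, `C_T = 0`). [formal bookkeeping] -/
theorem xRec_eq_xSm_of_good {M : ℕ} {z : Fin M → E3} {j : Fin M} (h : GoodAtScale (1 / 8) (3 / 2) z j) : xRec M z j = xSm M z j := by
  simp only [xRec, surplusCap, goodFlag, xSm, Wrec, if_pos h]; ring

/-- The record surplus never exceeds the smooth surplus (the flag column is `≤ 0`). [formal bookkeeping] -/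
theorem xRec_le_xSm {M : ℕ} (z : Fin M → E3) (j : Fin M) : xRec M z j ≤ xSm M z j := by
  by_cases h : GoodAtScale (1 / 8) (3 / 2) z j
  · exact (xRec_eq_xSm_of_good h).le
  · simp only [xRec, surplusCap, goodFlag, xSm, Wrec, if_neg h]
    split_ifs <;> linarith

/-- **`frozenAvg z c z₁ c₁ e`** — the cluster's smooth surpluses on its `63/10`-ball, summed with the INSTANCE's `9/5`-memberships and normalisers transported
by `e`: `Σ_{a : e a ∈ B(c₁)} x̃_a(z) / #B_{z₁}(e a)`. -/
noncomputable def frozenAvg {M : ℕ} (z : Fin M → E3) (c : Fin M) {M₁ : ℕ} (z₁ : Fin M₁ → E3) (c₁ : Fin M₁) (e : Fin M → Fin M₁) : ℝ :=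
  ∑ a ∈ (ball (63 / 10) z c).filter (fun a => e a ∈ ball (9 / 5) z₁ c₁), xSm M z a / ((ball (9 / 5) z₁ (e a)).card : ℝ)

/-- **`FineChart δ z c z₁ c₁ e`** — the deviation field is at most `δ` on the WHOLE `63/10`-ball (not only on its uncapped annulus). -/
def FineChart (δ : ℝ) {M : ℕ} (z : Fin M → E3) (c : Fin M) {M₁ : ℕ} (z₁ : Fin M₁ → E3) (c₁ : Fin M₁) (e : Fin M → Fin M₁) : Prop :=
  ∀ a, dist (z a) (z c) ≤ 63 / 10 → ‖dev z c z₁ c₁ e a‖ ≤ δ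

/-- **`linTerm G`** — the first-order term `Σ_{a ∈ B(c, 63/10)} G(z₁)(e a) (dev a)` through a GRADIENT TABLE `G` (a covector per instance site). -/
noncomputable def linTerm (G : (M₁ : ℕ) → (Fin M₁ → E3) → Fin M₁ → Fin M₁ → (E3 →L[ℝ] ℝ)) {M : ℕ} (z : Fin M → E3) (c : Fin M) {M₁ : ℕ}
    (z₁ : Fin M₁ → E3) (c₁ : Fin M₁) (e : Fin M → Fin M₁) : ℝ :=
  ∑ a ∈ ball (63 / 10) z c, G M₁ z₁ c₁ (e a) (dev z c z₁ c₁ e a)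

/-- **`quadTerm w`** — the second-order majorant in PAIR-DIFFERENCE (strain) currency `Σ_a Σ_a' w(z₁)(e a, e a')·‖dev a − dev a'‖²` through a CURVATURE
WEIGHT TABLE `w` (translation invariant: an affine-free or rigid-body-free reading of `dev` costs nothing extra). -/
noncomputable def quadTerm (w : (M₁ : ℕ) → (Fin M₁ → E3) → Fin M₁ → Fin M₁ → Fin M₁ → ℝ) {M : ℕ} (z : Fin M → E3) (c : Fin M) {M₁ : ℕ}
    (z₁ : Fin M₁ → E3) (c₁ : Fin M₁) (e : Fin M → Fin M₁) : ℝ :=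
  ∑ a ∈ ball (63 / 10) z c, ∑ a' ∈ ball (63 / 10) z c, w M₁ z₁ c₁ (e a) (e a') * ‖dev z c z₁ c₁ e a - dev z c z₁ c₁ e a'‖ ^ 2

/-! ## §2. The four pieces and the seam -/

/-- **(BAS) `InteriorBasin 𝓘 τ κA tmax δ`** [ANALYTIC — quantitative IFT · UNDECIDED · INSTRUMENTABLE] — admissible clean mono-phase clusters charted (`τ`,
fine `κA·t`, `0 ≤ t ≤ tmax`) by an instance of `𝓘` are `δ`-finely charted. -/
def InteriorBasin (𝓘 : (M₀ : ℕ) → (Fin M₀ → E3) → Fin M₀ → Prop) (τ κA tmax δ : ℝ) : Prop :=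
  ∀ (M : ℕ) (z : Fin M → E3) (c : Fin M) (M₁ : ℕ) (z₁ : Fin M₁ → E3) (c₁ : Fin M₁) (e : Fin M → Fin M₁) (t : ℝ),
    Admissible M z c → CleanBall (63 / 10) z c → MonoPhaseBall (63 / 10) z c → 0 ≤ t → t ≤ tmax → ChartBy 𝓘 τ (κA * t) z c z₁ c₁ e →
      FineChart δ z c z₁ c₁ e

/-- **(T2) `SmoothTaylorTwo 𝓘 τ δ G w ϱ`** [CALCULUS — the second-order remainder lemma · TRUE-type for `G` the true gradient and `w` a Hessian majorant on the
`2δ`-thickened pair distances · ATTACKABLE] — for a separated cluster `δ`-finely charted by an instance of `𝓘`: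
`S(z₁) + lin_G(dev) − quad_w(dev) − ϱ(z₁) ≤ frozenAvg`.  (`S(z₁) ≤` its smooth version by `xRec_le_xSm`; unmatched rim pairs have `W ≤ 0`.) -/
def SmoothTaylorTwo (𝓘 : (M₀ : ℕ) → (Fin M₀ → E3) → Fin M₀ → Prop) (τ δ : ℝ) (G : (M₁ : ℕ) → (Fin M₁ → E3) → Fin M₁ → Fin M₁ → (E3 →L[ℝ] ℝ))
    (w : (M₁ : ℕ) → (Fin M₁ → E3) → Fin M₁ → Fin M₁ → Fin M₁ → ℝ) (ϱ : (M₁ : ℕ) → (Fin M₁ → E3) → Fin M₁ → ℝ) : Prop :=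
  ∀ (M : ℕ) (z : Fin M → E3) (c : Fin M) (M₁ : ℕ) (z₁ : Fin M₁ → E3) (c₁ : Fin M₁) (e : Fin M → Fin M₁) (t : ℝ),
    Admissible M z c → ChartBy 𝓘 τ t z c z₁ c₁ e → FineChart δ z c z₁ c₁ e →
      ballAvg (9 / 5) z₁ (xRec M₁ z₁) c₁ + linTerm G z c z₁ c₁ e - quadTerm w z c z₁ c₁ e - ϱ M₁ z₁ c₁ ≤ frozenAvg z c z₁ c₁ e

/-- **(MEM) `MembershipColumn 𝓘 τ δ μ`** [COMBINATORIAL + TABLE · INSTRUMENTABLE] — for an admissible clean cluster `δ`-finely charted by an instance of `𝓘`,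
the true score is at least the frozen average minus the MEMBERSHIP COLUMN `μ(z₁)` (membership / normaliser transitions across the `9/5`-sphere; `0` on
instances whose shells clear `9/5 ± 2δ`). -/
def MembershipColumn (𝓘 : (M₀ : ℕ) → (Fin M₀ → E3) → Fin M₀ → Prop) (τ δ : ℝ) (μ : (M₁ : ℕ) → (Fin M₁ → E3) → Fin M₁ → ℝ) : Prop :=
  ∀ (M : ℕ) (z : Fin M → E3) (c : Fin M) (M₁ : ℕ) (z₁ : Fin M₁ → E3) (c₁ : Fin M₁) (e : Fin M → Fin M₁) (t : ℝ),
    Admissible M z c → CleanBall (63 / 10) z c → ChartBy 𝓘 τ t z c z₁ c₁ e → FineChart δ z c z₁ c₁ e →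
      frozenAvg z c z₁ c₁ e - μ M₁ z₁ c₁ ≤ ballAvg (9 / 5) z (xRec M z) c

/-- **(LIN) `SlavedFirstOrder P 𝓘 τ κA tmax δ G w Ψ`** [MECHANICS — the slaving estimate · UNDECIDED · INSTRUMENTABLE] — for admissible clean mono-phase clusters
charted (`τ`, fine `κA·t`, `0 ≤ t ≤ tmax`, chart predicate `P … t`) and `δ`-finely charted by an instance of `𝓘`: `−Ψ(z₁)(t) ≤ lin_G(dev) − quad_w(dev)` (force
cap `σ₁` + stability slave the interior deviation to the annulus roughness `t`; the tables `Ψ` are the census's per-instance dual norms).  No score in it. -/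
def SlavedFirstOrder (P : (M : ℕ) → (Fin M → E3) → Fin M → (M₁ : ℕ) → (Fin M₁ → E3) → Fin M₁ → (Fin M → Fin M₁) → ℝ → Prop)
    (𝓘 : (M₀ : ℕ) → (Fin M₀ → E3) → Fin M₀ → Prop) (τ κA tmax δ : ℝ) (G : (M₁ : ℕ) → (Fin M₁ → E3) → Fin M₁ → Fin M₁ → (E3 →L[ℝ] ℝ))
    (w : (M₁ : ℕ) → (Fin M₁ → E3) → Fin M₁ → Fin M₁ → Fin M₁ → ℝ) (Ψ : (M₁ : ℕ) → (Fin M₁ → E3) → Fin M₁ → ℝ → ℝ) : Prop :=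
  ∀ (M : ℕ) (z : Fin M → E3) (c : Fin M) (M₁ : ℕ) (z₁ : Fin M₁ → E3) (c₁ : Fin M₁) (e : Fin M → Fin M₁) (t : ℝ),
    Admissible M z c → CleanBall (63 / 10) z c → MonoPhaseBall (63 / 10) z c → 0 ≤ t → t ≤ tmax → ChartBy 𝓘 τ (κA * t) z c z₁ c₁ e →
      P M z c M₁ z₁ c₁ e t → FineChart δ z c z₁ c₁ e → -Ψ M₁ z₁ c₁ t ≤ linTerm G z c z₁ c₁ e - quadTerm w z c z₁ c₁ e

/-- ★★ THE LEVEL-2 SEAM: (BAS) ∧ (T2) ∧ (MEM) ∧ (LIN) ⟹ (ENV_P) with modulus `Ψ + ϱ + μ`.  Three inequalities added. [folklore] -/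
theorem familyEnvelopeOn_of_taylor {P : (M : ℕ) → (Fin M → E3) → Fin M → (M₁ : ℕ) → (Fin M₁ → E3) → Fin M₁ → (Fin M → Fin M₁) → ℝ → Prop}
    {𝓘 : (M₀ : ℕ) → (Fin M₀ → E3) → Fin M₀ → Prop} {τ κA tmax δ : ℝ} {G : (M₁ : ℕ) → (Fin M₁ → E3) → Fin M₁ → Fin M₁ → (E3 →L[ℝ] ℝ)}
    {w : (M₁ : ℕ) → (Fin M₁ → E3) → Fin M₁ → Fin M₁ → Fin M₁ → ℝ} {ϱ μ : (M₁ : ℕ) → (Fin M₁ → E3) → Fin M₁ → ℝ}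
    {Ψ : (M₁ : ℕ) → (Fin M₁ → E3) → Fin M₁ → ℝ → ℝ} (hB : InteriorBasin 𝓘 τ κA tmax δ) (hT : SmoothTaylorTwo 𝓘 τ δ G w ϱ)
    (hM : MembershipColumn 𝓘 τ δ μ) (hL : SlavedFirstOrder P 𝓘 τ κA tmax δ G w Ψ) :
    FamilyEnvelopeOn P 𝓘 τ κA tmax (fun M₁ z₁ c₁ t => Ψ M₁ z₁ c₁ t + ϱ M₁ z₁ c₁ + μ M₁ z₁ c₁) := by
  intro M z c M₁ z₁ c₁ e t hz hcl hm ht htm hch hP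
  have hf := hB M z c M₁ z₁ c₁ e t hz hcl hm ht htm hch
  have h₁ := hT M z c M₁ z₁ c₁ e (κA * t) hz hch hf
  have h₂ := hM M z c M₁ z₁ c₁ e (κA * t) hz hcl hch hf
  have h₃ := hL M z c M₁ z₁ c₁ e t hz hcl hm ht htm hch hP hf
  show _ - (Ψ M₁ z₁ c₁ t + ϱ M₁ z₁ c₁ + μ M₁ z₁ c₁) ≤ _
  linarith

/-! ## §3. The pins: `δ₀ = 1/20`, the true gradient table `G₀`, the curvature weight `w₀` (KBAND53), the rim column `ϱ₀` -/

/-- Level-2 pin: the fine tube radius `δ₀ = 1/20` (`≥ κA₀·tmax₀ = 1/30` on the annulus, plus the slaved interior excess). -/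
noncomputable def delta0 : ℝ := 1 / 20

/-- The frozen-membership smooth score of an instance as a function of a trial configuration `y` (memberships and normalisers of `z₁`). -/
noncomputable def froScore (M₁ : ℕ) (z₁ : Fin M₁ → E3) (c₁ : Fin M₁) (y : Fin M₁ → E3) : ℝ :=
  ∑ j ∈ ball (9 / 5) z₁ c₁, xSm M₁ y j / ((ball (9 / 5) z₁ j).card : ℝ)

/-- ★ **`G₀`** — the TRUE gradient table: the Fréchet derivative of the frozen smooth score in the position of site `b`, at the instance. -/
noncomputable def G0 : (M₁ : ℕ) → (Fin M₁ → E3) → Fin M₁ → Fin M₁ → (E3 →L[ℝ] ℝ) :=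
  fun M₁ z₁ c₁ b => fderiv ℝ (fun p : E3 => froScore M₁ z₁ c₁ (Function.update z₁ b p)) (z₁ b)

/-- ★ **`Kband r`** — band majorants of the Hessian norm of `p ↦ W(‖p‖)` on the `1/10`-thickened distance `r` (instrument KBAND53, grid `2·10⁻⁴`, ×1.2, rounded
up): `sup_{|s−r| ≤ 1/10, s ≥ 69/100} max(|W''(s)|, |W'(s)|/s) ≤ Kband r`; `0` beyond `47/10` (pairs at instance distance `≥ 47/10` stay beyond the range `9/2`). -/
noncomputable def Kband (r : ℝ) : ℝ :=
  if r < 4 / 5 then 2700 else if r < 17 / 20 then 2146 else if r < 9 / 10 then 792 else if r < 19 / 20 then 304 else if r < 21 / 20 then 121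
  else if r < 6 / 5 then 20 else if r < 3 / 2 then 1 else if r < 2 then 1 / 2 else if r < 3 then 1 / 20 else if r < 47 / 10 then 1 / 500 else 0

/-- ★ **`w₀`** — the curvature weight of record: `[b member]·Kband(r_bb') / (4·#B_{z₁}(b))` (`½` from `x̃ = ½ΣW`, `½` from Taylor). -/
noncomputable def w0 : (M₁ : ℕ) → (Fin M₁ → E3) → Fin M₁ → Fin M₁ → Fin M₁ → ℝ :=
  fun _ z₁ c₁ b b' => if b ∈ ball (9 / 5) z₁ c₁ then Kband (dist (z₁ b) (z₁ b')) / (4 * ((ball (9 / 5) z₁ b).card : ℝ)) else 0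

/-- ★ **`ϱ₀`** — the rim column of record: `δ₀ · Σ_{j member} Σ_{k : 119/20 < dist(z₁ k, z₁ c₁)} |W'(r_jk)| / (2·#B(j))` (gradient terms of the possibly
uncovered rim partners `63/10 − τ₁ = 119/20`; `|W'| ≤ 5.2·10⁻⁵` beyond `4`) plus `10⁻⁵` (partners of members beyond the chart ball, at pair distance `> 4.45`:
`|W| ≤ 10⁻⁷` on `[4.45, 9/2]`, at most `60` per member by separation). -/
noncomputable def rho0 : (M₁ : ℕ) → (Fin M₁ → E3) → Fin M₁ → ℝ :=
  fun _ z₁ c₁ => 1 / 100000 + delta0 * ∑ j ∈ ball (9 / 5) z₁ c₁,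
    (∑ k ∈ Finset.univ.filter (fun k => 119 / 20 < dist (z₁ k) (z₁ c₁)), |deriv Wrec (dist (z₁ j) (z₁ k))|) / (2 * ((ball (9 / 5) z₁ j).card : ℝ))

/-! ## §4. The record instantiation on the comparison family `𝓘₁⁺` of LINE A⁺ and the g53 node -/

/-- ★ **(BAS-bent₁)** `:= InteriorBasin 𝓘₁⁺ (7/20) 2 (1/60) (1/20)`. -/
def InteriorBasinBent1 : Prop := InteriorBasin CompFamily1 tau1 kA0 tmax0 delta0

/-- ★ **(T2-bent₁)** `:= SmoothTaylorTwo 𝓘₁⁺ (7/20) (1/20) G₀ w₀ ϱ₀` — THE SECOND-ORDER REMAINDER LEMMA OF RECORD (instances bent by `𝓑₁ ⊇ 𝓑₀`: `q₂ ≤ 11/2000`,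
`q₃ ≤ 11/20000`; `G₀` the true gradient; `w₀` KBAND53; `ϱ₀` the rim column). -/
def TaylorTwoBent1 : Prop := SmoothTaylorTwo CompFamily1 tau1 delta0 G0 w0 rho0

/-- ★ **(MEM-bent₁ μ)** `:= MembershipColumn 𝓘₁⁺ (7/20) (1/20) μ`. -/
def MembershipBent1 (μ : (M₁ : ℕ) → (Fin M₁ → E3) → Fin M₁ → ℝ) : Prop := MembershipColumn CompFamily1 tau1 delta0 μ

/-- ★ **(LIN-bent₁ Ψ)** `:= SlavedFirstOrder projectedFree 𝓘₁⁺ (7/20) 2 (1/60) (1/20) G₀ w₀ Ψ`. -/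
def SlavedBent1 (Ψ : (M₁ : ℕ) → (Fin M₁ → E3) → Fin M₁ → ℝ → ℝ) : Prop := SlavedFirstOrder projectedFree CompFamily1 tau1 kA0 tmax0 delta0 G0 w0 Ψ

/-- The sum modulus `Ψ + ϱ₀ + μ`. -/
noncomputable def withColumns (Ψ : (M₁ : ℕ) → (Fin M₁ → E3) → Fin M₁ → ℝ → ℝ) (μ : (M₁ : ℕ) → (Fin M₁ → E3) → Fin M₁ → ℝ) :
    (M₁ : ℕ) → (Fin M₁ → E3) → Fin M₁ → ℝ → ℝ :=
  fun M₁ z₁ c₁ t => Ψ M₁ z₁ c₁ t + rho0 M₁ z₁ c₁ + μ M₁ z₁ c₁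

/-- ★★ LEVEL-2 NODE OF RECORD: (BAS-bent₁) ∧ (T2-bent₁) ∧ (MEM-bent₁ μ) ∧ (LIN-bent₁ Ψ) ⟹ (ENV-bent₁ (Ψ + ϱ₀ + μ)). [folklore] -/
theorem envelopeOnBent1_of_taylor {Ψ : (M₁ : ℕ) → (Fin M₁ → E3) → Fin M₁ → ℝ → ℝ} {μ : (M₁ : ℕ) → (Fin M₁ → E3) → Fin M₁ → ℝ} (hB : InteriorBasinBent1)
    (hT : TaylorTwoBent1) (hM : MembershipBent1 μ) (hL : SlavedBent1 Ψ) : EnvelopeOnBent1 (withColumns Ψ μ) :=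
  familyEnvelopeOn_of_taylor hB hT hM hL

/-- ★★★ THE g53 NODE OF RECORD (levels 2 + 1 + 0, ten pieces, every seam proved): for any tables `Ψ, μ`,
(BAS-bent₁) ∧ (T2-bent₁) ∧ (MEM-bent₁ μ) ∧ (LIN-bent₁ Ψ) ∧ (RF-bent₁) ∧ (DOM-bent₁ (Ψ+ϱ₀+μ)) ∧ (F2-bent₀) ∧ (F3-bent₁) ∧ [BRIDGE] `BandFarFloor … (3/50) (1/10) 0` ∧
[SOFT-FAR] `SoftFarFloor … (1/10) 0` ⟹ [CORE-FAR] `CoreOffTubeFloor (63/10) (63/10) (24/5) (1/100) 0`. [folklore] -/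
theorem coreOff_record_g53 {Ψ : (M₁ : ℕ) → (Fin M₁ → E3) → Fin M₁ → ℝ → ℝ} {μ : (M₁ : ℕ) → (Fin M₁ → E3) → Fin M₁ → ℝ}
    (hB : InteriorBasinBent1) (hT : TaylorTwoBent1) (hM : MembershipBent1 μ) (hL : SlavedBent1 Ψ) (hRF : AffineRefitBent1)
    (hD : DominationBent1 (withColumns Ψ μ)) (hR : FamilyRoomBent0) (hC : FamilyCertBent1)
    (hBand : BandFarFloor (63 / 10) (63 / 10) (24 / 5) (1 / 100) (3 / 50) (1 / 10) 0) (hS : SoftFarFloor (63 / 10) (63 / 10) (24 / 5) (1 / 100) (1 / 10) 0) :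
    CoreOffTubeFloor (63 / 10) (63 / 10) (24 / 5) (1 / 100) 0 :=
  coreOff_record_capBent1 (familyEnvelopeCapBent1_of_pieces hRF (envelopeOnBent1_of_taylor hB hT hM hL) hD) hR hC hBand hS

/-- ★★ The EDGE band alone (no bridge, no residual): the eight analytic pieces ⟹ `EdgeFarFloor (63/10) (63/10) (24/5) (1/100) (3/50) 0`. [folklore] -/
theorem edgeFar_record_g53 {Ψ : (M₁ : ℕ) → (Fin M₁ → E3) → Fin M₁ → ℝ → ℝ} {μ : (M₁ : ℕ) → (Fin M₁ → E3) → Fin M₁ → ℝ}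
    (hB : InteriorBasinBent1) (hT : TaylorTwoBent1) (hM : MembershipBent1 μ) (hL : SlavedBent1 Ψ) (hRF : AffineRefitBent1)
    (hD : DominationBent1 (withColumns Ψ μ)) (hR : FamilyRoomBent0) (hC : FamilyCertBent1) :
    EdgeFarFloor (63 / 10) (63 / 10) (24 / 5) (1 / 100) (3 / 50) 0 :=
  edgeFar_capBent1 (familyEnvelopeCapBent1_of_pieces hRF (envelopeOnBent1_of_taylor hB hT hM hL) hD) hR hC

end Summit.AtomisticToContinuum.Crystallization.Theorems.FrustratedLawDichotomyStrainedPatchEnvelopeTaylor
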